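import Summits.BirchSwinnertonDyer.BirchSwinnertonDyer.Theorems.ByReductionTypeAtTwoAdditiveKatoTransportNegTwoPrintExact
import Summits.BirchSwinnertonDyer.BirchSwinnertonDyer.Theorems.ByReductionTypeAtTwoAdditiveKatoTransportPrintExact
import HarnessLib

/-!
# Route ByReductionTypeAtTwo, crux C4″ `AdditivePotMultOverKAtTwo` (stmt-BirchSwinnertonDyer-22618; parent
# `AdditiveRankZeroAtTwo` 19098) — R16: ONE object-level input at `p = 2` for ALL FOUR split-twist potentially-multiplicative
# sub-blocks ((−1)/(−2) × `E[2]` irreducible/reducible): the PRINT-EXACT odd-branch §17.13 packages of addL2x GEN 16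
# (`KatoOddBranchInputsAtTwoNegOneSplitTwistPrintExact`, p683821; `…NegTwo…PrintExact`, p684511) with their SCOPE-ONLY binder
# «`W[2]` irreducible» dropped (two `@[conjecture]` constants, nothing asserted) + pure logic

Cell `bsd-2adic` (run/shared/lean/pub/bsd-2adic/), seat `bsd-2adic-k4-w3` GEN 4 (explicit unit of director-bsd g16 (309)(7):
«C4″ 22618 narrowed — split-twist reducible + irreducible Kato 12.10 upper half at 2»). Pattern of the two GEN 16 files named
above and of this seat's GEN 0 file `…AdditiveReducibleSplitTwistKatoMemberDefs.lean` (p682167), whose §1 did the same for the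
KEY-`γ` species `KatoOddBranchInputsAtTwoNegOneSplitTwist` (constant `…AnyImage`); pen rulings RC-307 (β) (statements at `p = 2`
beyond the printed range are Summits-side `@[conjecture]` constants consumed BY NAME) and RC-364 (1) AP4 (ONE convention per door;
the PRINT-EXACT key-`γ⁻¹` home is the flag-free species — the key-`γ` species carries the cell's ARM-P reading flag
`Kato-1713-dual-action`, cf. `Literature/…/Kato2004/DivisibilityInputsContragredient.lean`).

WHY (R16). After GEN 2/3 (R15 kernel: `AddKatoTwoGammaTwist.katoOddBranchInputsNegOnePrintExact_iff_negTwo`, p696121/p696613)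
the two IRREDUCIBLE split-twist blocks of C4″ hang on ONE typed input, `KatoOddBranchInputsAtTwoNegOneSplitTwistPrintExact`; the
two REDUCIBLE blocks (GEN 0's member-sharp targets `KatoMemberSharpAtTwoAdditiveNeg{One,Two}SplitTwistReducible`, R14) were
priced modulo a DIFFERENT constant — GEN 0's key-`γ` `KatoOddBranchInputsAtTwoNegOneSplitTwistAnyImage` (flagged species) — and
R15 for them stayed a READING, only because every kernel door of the lane (`lengthAt_selmerDualContra_le_of_oddBranchInputsPrintExact`,
`…KeyGamma`, the `_fe` twins, GEN 2/3's transport) inherits the binder `W.HasIrreducibleModPGaloisRep 2` from the typed input it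
destructures. That binder is SCOPE-ONLY: the package's content — Kato Thm. 12.4, Thm. 12.5 (1)–(3) with (12.5.1), Thm. 12.6 for
`f_W`, (17.13.1) «exact upto ×2», 13.13, Thm. 16.2/16.6 for `f_{W^{(−1)}}` with `α = a₂ = 1`, the Coleman clause — carries NO
hypothesis on the image of `ρ_{W,2}`: in Kato's Thm. 12.5 the image condition (12.5.2) («the image of `Gal(ℚ̄/ℚ(ζ_{p^∞}))` contains
`SL₂(ℤ_p)`») and `p ≠ 2` enter ONLY part (4) (p. 222), which no statement of this lane uses; the Literature construction facts
`Kato2004.exists_multDivisibilityInputs_{nonsplit,split}_contra` (odd `p`) carry no image hypothesis either. This file therefore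
types the two print-exact packages WITHOUT the binder (§1) and records the pure logic (§2): each implies its GEN 16 twin. The
sequel files (this GEN) re-run the lane's doors and GEN 2/3's R15 transport against §1 — so that ALL FOUR block targets
{`KatoSharpAtTwoAdditiveNeg{One,Two}SplitTwist` (irreducible, + (A)), `KatoMemberSharpAtTwoAdditiveNeg{One,Two}SplitTwistReducible`
(reducible, (A) is PRINT there)} are reading-grade modulo the ONE constant `KatoOddBranchInputsAtTwoNegOneSplitTwistPrintExactAnyImage`,
in the flag-free species, with the `(−2)`-twin a THEOREM modulo it. GEN 0's key-`γ` constant is thereby SUPERSEDED for pricing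
(not deleted; no kernel relation between the two species is claimed — they differ by the `ι`-semilinearity of one crossing map
of (17.13.1), exactly the content of the reading flag).

HONEST FRAMING (cell `bsd-2adic`, HUMAN RULING D-0036/D-0054): TWO typed constants (nothing asserted; conjecture-grade at `2`
exactly like `Kato2004.exists_multDivisibilityInputs_split_contra` at `p = 2` / the multiplicative lane's K11b: Kato §16 PRINT at
`2` (audit-2 sheet AP1), Coleman clause = Kobayashi 2006 Thm. 4.1 printed for ODD `p` only) and pure-logic lemmas;
types-the-object-of; closes none; nothing booked; BSD is not proved by any of this. PARTITION: X5@2 additive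
potentially-multiplicative block, the four (−1)/(−2) × irreducible/reducible split-twist sub-blocks (169 + 39 classes;
128 + 30 irreducible, 41 + 9 reducible; census `addL2x/gen13/POTMULT-NST-CENSUS-19098-addL2x-GEN13.tsv`) × `p = 2`.

WHAT IS NOT CLAIMED: the constants themselves; any relation between the key-`γ` and key-`γ⁻¹` species beyond the existing
END-statement doors; anything about CM or analytic rank `1`; lower bounds; the descent readings T1–T14 / R1–R13; the
twist-decomposition reading T20 (a) (`hdec`, seat t42 GEN 23's lane).

References: [Kato2004Asterisque] §12.2 (p. 220), Thm. 12.4 (p. 221), Thm. 12.5 (1)–(4) with (12.5.1)/(12.5.2) (pp. 221–222),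
Thm. 12.6 (p. 222), 13.13 (pp. 233–234), 14.9 (p. 239), §16.1, Thm. 16.2, 16.6 (pp. 268–271), §17.3 (p. 273), §17.13
(pp. 279–280); [Kobayashi2006DocMath] Thm. 4.1 (odd p); [Greenberg1989] pp. 101–102 (`S^ι`); [GreenbergLNM1716] Thm. 1.14
(p. 68), §4 (p. 107); [MazurTateTeitelbaum1986Invent] §I.10, §I.13, §I.17; memos
`run/shared/lean/pub/bsd-2adic/k4w3/gen{0,2,3}/VERDICT-22618-k4w3-GEN{0,2,3}.md`,
`run/shared/lean/pub/bsd-2adic/addL2x/VERDICT-19098-addL2x-GEN16.md`.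
-/

set_option autoImplicit false
-- the summit's namespace `Summit.BirchSwinnertonDyer.BirchSwinnertonDyer` (Sub = Summit) trips `dupNamespace`
set_option linter.dupNamespace false

noncomputable section

open scoped Classical MatrixGroups ModularForm

open Field CongruenceSubgroup WeierstrassCurve Literature.NumberTheory.EllipticCurves
  Literature.NumberTheory.EllipticCurves.ModularForms Literature.NumberTheory.EllipticCurves.IwasawaAlgebra
  Literature.NumberTheory.EllipticCurves.Module

namespace Summit.BirchSwinnertonDyer.BirchSwinnertonDyer.Theorems.AddKatoTwo

/-! ## §1 The two print-exact odd-branch packages at `2`, IMAGE-FREE spelling -/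

/-- [crux input, MEMO — PRINT-EXACT home of T20 (b), IMAGE-FREE] **The ODD-BRANCH §17.13 package at `p = 2` for an additive
curve whose twist by `−1` is split multiplicative at `2`, over the dual Selmer datum of key `γ⁻¹`, WITHOUT a hypothesis on the
image of `ρ̄_{W,2}`** — `KatoOddBranchInputsAtTwoNegOneSplitTwistPrintExact` (addL2x GEN 16, p683821) VERBATIM with its binder
`W.HasIrreducibleModPGaloisRep 2 →` dropped (that binder only restricted GEN 16's scope to the irreducible block; every
ingredient of T20 (b) is image-free — in Kato's Thm. 12.5 the image condition (12.5.2) and `p ≠ 2` enter only part (4),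
unused here). For every globally minimal `W/ℚ` with `W^{(−1)}` SPLIT multiplicative at `2`, cyclotomic `κ` with generator `γ`,
`κ_cyc(γ) = 5`, every newform `f` of `W^{(−1)}`, every `I = 𝐇¹_Γ(T₂W)` and every `D' : W.SelmerDualData κ γ⁻¹`: a
`Kato2004.MultDivisibilityInputsContra W 2 L κ γ I D'` for `L = ι(5T+4)·L⁻`, `L⁻ = padicLFunctionMinusBranchMult f 1 1` (the
`ω`-branch of the ONE-term Mazur–Tate–Teitelbaum measure of `W^{(−1)}`, `α = a₂ = 1`), whose Coleman map has cokernel of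
length `0` at every height-one `𝔮 ∌ 2` and whose local term `H2loc` (Thm. 12.5 (3); `= Λ/(γ − κ(γ)⁻¹) = Λ/(5T+4)` by 13.13)
has length `0` at every height-one `𝔮 ∌ 2` other than `(5T + 4)`. This is the ONE input under which all four split-twist
block targets of C4″ are reading-grade (module docstring, R16); it implies GEN 16's constant
(`katoOddBranchInputsAtTwoNegOneSplitTwistPrintExact_of_anyImage`) and — by the sequel file's image-free R15 transport —
its own `(−2)`-twin below. Conjecture-grade at `2` exactly like `Kato2004.exists_multDivisibilityInputs_split_contra` at
`p = 2` (print at odd `p`: Kato §16 + Kobayashi 2006 Thm. 4.1). Nothing asserted.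
[cite: Kato2004Asterisque, Thm. 12.4 (1) (p. 221), Thm. 12.5 (1)–(3) with (12.5.1) (pp. 221–222), Thm. 12.6 (p. 222), 13.13 (pp. 233–234), §16.1 and Thm. 16.2, 16.6 (pp. 268–271), §17.3 (p. 273), §17.13 (pp. 279–280)]
[cite: Kobayashi2006DocMath, Thm. 4.1 (odd p)] [cite: Greenberg1989, pp. 101–102 (S^ι)] -/
@[conjecture] def KatoOddBranchInputsAtTwoNegOneSplitTwistPrintExactAnyImage : Prop :=
  ∀ (W : WeierstrassCurve ℚ) [W.IsElliptic] [W.IsGloballyMinimal]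
    [ContinuousSMul ℤ_[2] (W.tateModule 2)] {N : ℕ} [NeZero N] (f : CuspForm (Gamma0 N) 2)
    (κ : ZpExtension ℚ 2) (γ : absoluteGaloisGroup ℚ),
    (W.quadraticTwist (-1)).HasSplitMultiplicativeReductionAtPrime 2 →
    κ.IsCyclotomic → κ.IsTopGenerator γ → IsCyclotomicVariable 2 γ → IsNewformOf (W.quadraticTwist (-1)) f →
    ∀ (I : Kato2004.IwasawaH1Data W 2 κ γ) (D' : W.SelmerDualData κ γ⁻¹),
      ∃ K : Kato2004.MultDivisibilityInputsContra W 2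
          (iwasawaToPowerSeries 2 (PowerSeries.C 5 * PowerSeries.X + PowerSeries.C 4) *
            padicLFunctionMinusBranchMult f (1 : ℚ_[2]) 1) κ γ I D',
        (∀ 𝔮 : PrimeSpectrum (IwasawaAlgebra 2), 𝔮.asIdeal.height = 1 →
            PowerSeries.C (2 : ℤ_[2]) ∉ 𝔮.asIdeal →
            Module.lengthAt (IwasawaAlgebra 2) (IwasawaAlgebra 2 ⧸ LinearMap.range K.col) 𝔮 = 0) ∧
        (∀ 𝔮 : PrimeSpectrum (IwasawaAlgebra 2), 𝔮.asIdeal.height = 1 →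
            PowerSeries.C (2 : ℤ_[2]) ∉ 𝔮.asIdeal →
            𝔮.asIdeal ≠ Ideal.span {(PowerSeries.C 5 * PowerSeries.X + PowerSeries.C 4 : IwasawaAlgebra 2)} →
            Module.lengthAt (IwasawaAlgebra 2) K.H2loc 𝔮 = 0)

/-- [crux input, MEMO — the (−2)-block twin, IMAGE-FREE] **The `ω·χ₂`-BRANCH §17.13 package at `p = 2` for an additive curve
whose twist by `−2` is split multiplicative at `2`, over the dual Selmer datum of key `γ⁻¹`, WITHOUT a hypothesis on the image
of `ρ̄_{W,2}`** — `KatoOddBranchInputsAtTwoNegTwoSplitTwistPrintExact` (addL2x GEN 16, p684511) VERBATIM with its binder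
`W.HasIrreducibleModPGaloisRep 2 →` dropped. For every globally minimal `W/ℚ` with `W^{(−2)}` SPLIT multiplicative at `2`,
cyclotomic `κ`, `γ`, `κ_cyc(γ) = 5`, every newform `f` of `W^{(−2)}`, every `I = 𝐇¹_Γ(T₂W)` and `D' : W.SelmerDualData κ γ⁻¹`:
a package for `L = ι(5T+6)·L⁻₂`, `L⁻₂ = padicLFunctionMinusBranchMultTwist f 1 1 (−1)` (the `ω·χ₂`-branch; `χ₂(γ) = −1`),
Coleman cokernel of length `0` off `(2)`, local term (`= Λ/(5T+6)` by 13.13) of length `0` off `(2)` and off `(5T + 6)`.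
Recorded for symmetry of names only: by the sequel file (image-free R15, GEN 2/3's transport re-run) it is EQUIVALENT to
`KatoOddBranchInputsAtTwoNegOneSplitTwistPrintExactAnyImage`; it implies GEN 16's `(−2)` constant
(`katoOddBranchInputsAtTwoNegTwoSplitTwistPrintExact_of_anyImage`). Conjecture-grade at `2` (same footing). Nothing asserted.
[cite: Kato2004Asterisque, Thm. 12.4 (1) (p. 221), Thm. 12.5 (1)–(3) with (12.5.1) (pp. 221–222), Thm. 12.6 (p. 222), 13.13 (pp. 233–234), §16.1 and Thm. 16.2, 16.6 (pp. 268–271), §17.3 (p. 273), §17.13 (pp. 279–280)]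
[cite: Kobayashi2006DocMath, Thm. 4.1 (odd p)] [cite: Greenberg1989, pp. 101–102 (S^ι)] -/
@[conjecture] def KatoOddBranchInputsAtTwoNegTwoSplitTwistPrintExactAnyImage : Prop :=
  ∀ (W : WeierstrassCurve ℚ) [W.IsElliptic] [W.IsGloballyMinimal]
    [ContinuousSMul ℤ_[2] (W.tateModule 2)] {N : ℕ} [NeZero N] (f : CuspForm (Gamma0 N) 2)
    (κ : ZpExtension ℚ 2) (γ : absoluteGaloisGroup ℚ),
    (W.quadraticTwist (-2)).HasSplitMultiplicativeReductionAtPrime 2 →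
    κ.IsCyclotomic → κ.IsTopGenerator γ → IsCyclotomicVariable 2 γ → IsNewformOf (W.quadraticTwist (-2)) f →
    ∀ (I : Kato2004.IwasawaH1Data W 2 κ γ) (D' : W.SelmerDualData κ γ⁻¹),
      ∃ K : Kato2004.MultDivisibilityInputsContra W 2
          (iwasawaToPowerSeries 2 (PowerSeries.C 5 * PowerSeries.X + PowerSeries.C 6) *
            padicLFunctionMinusBranchMultTwist f (1 : ℚ_[2]) 1 (-1)) κ γ I D',
        (∀ 𝔮 : PrimeSpectrum (IwasawaAlgebra 2), 𝔮.asIdeal.height = 1 →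
            PowerSeries.C (2 : ℤ_[2]) ∉ 𝔮.asIdeal →
            Module.lengthAt (IwasawaAlgebra 2) (IwasawaAlgebra 2 ⧸ LinearMap.range K.col) 𝔮 = 0) ∧
        (∀ 𝔮 : PrimeSpectrum (IwasawaAlgebra 2), 𝔮.asIdeal.height = 1 →
            PowerSeries.C (2 : ℤ_[2]) ∉ 𝔮.asIdeal →
            𝔮.asIdeal ≠ Ideal.span {(PowerSeries.C 5 * PowerSeries.X + PowerSeries.C 6 : IwasawaAlgebra 2)} →
            Module.lengthAt (IwasawaAlgebra 2) K.H2loc 𝔮 = 0)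

/-! ## §2 Pure logic: the image-free packages imply addL2x GEN 16's (scope «`W[2]` irreducible») -/

/-- **The image-free (−1) package implies GEN 16's** `KatoOddBranchInputsAtTwoNegOneSplitTwistPrintExact` (the same statement
under the extra binder «`W[2]` irreducible»). Pure logic; recorded so that ONE object-level input serves the irreducible
(−1)-block target `KatoSharpAtTwoAdditiveNegOneSplitTwist` (T20), the reducible one `KatoMemberSharpAtTwoAdditiveNegOneSplitTwistReducible`
(R14), and — through R15 — both (−2)-block targets. [cite: Kato2004Asterisque, Thm. 12.5 (3)(4) with (12.5.1)/(12.5.2) (p. 222), §17.13 (pp. 279–280)] -/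
theorem katoOddBranchInputsAtTwoNegOneSplitTwistPrintExact_of_anyImage
    (h : KatoOddBranchInputsAtTwoNegOneSplitTwistPrintExactAnyImage) :
    KatoOddBranchInputsAtTwoNegOneSplitTwistPrintExact := by
  intro W _ _ _ N _ f κ γ hsp _hirr hκ hγ hcv hf I D'
  exact h W f κ γ hsp hκ hγ hcv hf I D'

/-- **The image-free (−2) package implies GEN 16's** `KatoOddBranchInputsAtTwoNegTwoSplitTwistPrintExact`. Pure logic.
[cite: Kato2004Asterisque, Thm. 12.5 (3)(4) with (12.5.1)/(12.5.2) (p. 222), §17.13 (pp. 279–280)] -/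
theorem katoOddBranchInputsAtTwoNegTwoSplitTwistPrintExact_of_anyImage
    (h : KatoOddBranchInputsAtTwoNegTwoSplitTwistPrintExactAnyImage) :
    KatoOddBranchInputsAtTwoNegTwoSplitTwistPrintExact := by
  intro W _ _ _ N _ f κ γ hsp _hirr hκ hγ hcv hf I D'
  exact h W f κ γ hsp hκ hγ hcv hf I D'

end Summit.BirchSwinnertonDyer.BirchSwinnertonDyer.Theorems.AddKatoTwo

end
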